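import Summits.CriticalPhenomena.PercolationContinuityZ3.Theorems.PercNearOneGluingNoHeavyLowerTailSahiHubCorner
import Mathlib.Tactic.Linarith
import Mathlib.Tactic.Ring
import HarnessLib

/-!
# `NoHeavyLowerTail` (crux stmt-CriticalPhenomena-4575), P2 — **Kahn's `C₃` on T₁ when the hub is REQUIRED by the third member**
# (first unconditional case of the hub-corner criterion beyond |C| = 1; arbitrary finite FKG co-shared block)

Memo `FROM-prim-masterthm-p2-g30-CORNER-POLARISATION.md` §1 (trivial faces), SAHI-ROUTE.md §4.57 (seat `prim-masterthm-p2`, gen 30;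
`--supports stmt-CriticalPhenomena-4575`).  No `sorry`, no named facts, standard axioms.  Uses only `…SahiHubCorner`
(`cornerQ1_eq_levels`, `cornerQ0_eq_levels`, `sahiE_three_nonneg_T1_of_corner`) and class T (`SahiTriangleClassT`).

SETTING (`…SahiHubCorner`): `f z c a, g z c b, h z a b` — `f, g` share the hub coin `z` and an ARBITRARY finite FKG block `γ`
(cube of any dimension with a product law, chain, …), `h` sees the hub and the private blocks `α, β` but not `γ`.
HYPOTHESIS OF THIS FILE: `h 0 = 0` — the third member REQUIRES the hub (for up-sets: every minimal set of the third event contains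
`z`, i.e. `h = x_z ∧ h'(a,b)`).

* `cornerQ1_nonneg_of_hub_required`, `cornerQ0_nonneg_of_hub_required` — both hub-corner forms are `≥ 0` when `h 0 = 0`:
  by the symmetric closed forms, `q₁ = P₁ + ΔF̄·Cov¹(g,h) + ΔḠ·Cov¹(f,h) + H̄₁[E¹(fg) − E⁰(fg)]` and
  `q₀ ≥ H̄₁(F̄₁ − F̄₀)(Ḡ₁ − Ḡ₀)` (after `E¹(gh) ≥ Ḡ₁H̄₁`, `E¹(fh) ≥ F̄₁H̄₁`, `E¹(fg) ≥ E⁰(fg)`), every term a class-T `E₃`, an FKG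
  covariance or a product of nonnegative increments.
* `sahiE_three_nonneg_T1_of_hub_required` — **THEOREM: Kahn's `C₃` / Sahi's `E₃ ≥ 0` for every such triple at every hub bias**:
  for increasing events on a cube with a product measure: `C₃` holds for every triple with exactly one coordinate `z` essential to all
  three events whenever `z` is REQUIRED by one of them (the other two may share any further set of coordinates).  Not contained in the
  tree's T₁(|C|=1) (`…SahiHubTwoLevelI3`), class T, Theorem A/C, or the shell faces of `…SahiLevelSplit`. [this work]
-/

noncomputable section

open scoped Classical

namespace Summit.CriticalPhenomena.PercolationContinuityZ3.Theorems

namespace SahiHubCorner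

open Finset Literature.Combinatorics.Sahi2008
open SahiTriangleClassT (Y FC HH GG GC Ybar Hbar Gbar expectations FHbar_le_Ybar)
open SahiTriangleSupermodular (fkg_sum)

variable {α β γ : Type} [Fintype α] [Fintype β] [Fintype γ]
  {wA : α → ℝ} {wB : β → ℝ} {wC : γ → ℝ} {wZ : Fin 2 → ℝ}
  {f : Fin 2 → γ → α → ℝ} {g : Fin 2 → γ → β → ℝ} {h : Fin 2 → α → β → ℝ}

/-- The level-`z` moments in the slice vocabulary of `SahiTriangleClassT` (the bridge `exL ↔ ex` is definitional). [this work] -/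
theorem exL_moments (z : Fin 2) (hA1 : ∑ a, wA a = 1) (hB1 : ∑ b, wB b = 1) (hC1 : ∑ c, wC c = 1) :
    exL wA wB wC z (F1 f * F2 g * F3 h) = ∑ c, wC c * ∑ b, wB b * (g z c b * Y wA (f z) (h z) c b) ∧
    exL wA wB wC z (F1 f * F2 g) = ∑ c, wC c * (FC wA (f z) c * GC wB (g z) c) ∧
    exL wA wB wC z (F1 f * F3 h) = ∑ c, wC c * Ybar wA wB (f z) (h z) c ∧
    exL wA wB wC z (F1 f) = ∑ c, wC c * FC wA (f z) c ∧
    exL wA wB wC z (F2 g * F3 h) = ∑ b, wB b * (GG wC (g z) b * HH wA (h z) b) ∧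
    exL wA wB wC z (F2 g) = Gbar wB wC (g z) ∧
    exL wA wB wC z (F3 h) = Hbar wA wB (h z) :=
  expectations (wA := wA) (wB := wB) (wC := wC) (f := f z) (g := g z) (h := h z) hA1 hB1 hC1

section Facts
variable [DistribLattice α] [DistribLattice β]

/-- FKG facts at one level: `E(gh) ≥ E g·E h`, `E(fh) ≥ E f·E h`, and signs. [this work] -/
theorem level_facts (z : Fin 2) (hA : IsFKGMeasure wA) (hB : IsFKGMeasure wB) (hC0 : ∀ c, 0 ≤ wC c) (hC1 : ∑ c, wC c = 1)
    (hf0 : ∀ z c a, 0 ≤ f z c a) (hfa : ∀ z c, Monotone (f z c))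
    (hg0 : ∀ z c b, 0 ≤ g z c b) (hgb : ∀ z c, Monotone (g z c))
    (hh0 : ∀ z a b, 0 ≤ h z a b) (hha : ∀ z b, Monotone (fun a => h z a b)) (hhb : ∀ z a, Monotone (h z a)) :
    exL wA wB wC z (F2 g) * exL wA wB wC z (F3 h) ≤ exL wA wB wC z (F2 g * F3 h) ∧
    exL wA wB wC z (F1 f) * exL wA wB wC z (F3 h) ≤ exL wA wB wC z (F1 f * F3 h) ∧
    0 ≤ exL wA wB wC z (F1 f) ∧ 0 ≤ exL wA wB wC z (F2 g) ∧ 0 ≤ exL wA wB wC z (F3 h) := by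
  obtain ⟨-, -, e3, e4, e5, e6, e7⟩ := exL_moments (f := f) (g := g) (h := h) z hA.sum_eq_one hB.sum_eq_one hC1
  have hA0 := hA.nonneg; have hB0 := hB.nonneg
  refine ⟨?_, ?_, ?_, ?_, ?_⟩
  · rw [e5, e6, e7]; unfold Gbar Hbar
    refine fkg_sum hB (fun b => sum_nonneg fun c _ => mul_nonneg (hC0 c) (hg0 z c b))
      (fun b => sum_nonneg fun a _ => mul_nonneg (hA0 a) (hh0 z a b)) ?_ ?_
    · exact fun b b' hbb => sum_le_sum fun c _ => mul_le_mul_of_nonneg_left (hgb z c hbb) (hC0 c)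
    · exact fun b b' hbb => sum_le_sum fun a _ => mul_le_mul_of_nonneg_left (hhb z a hbb) (hA0 a)
  · rw [e3, e4, e7, sum_mul]
    exact sum_le_sum fun c _ => by
      have := FHbar_le_Ybar (wB := wB) hA hB0 (hf0 z) (hh0 z) (hfa z) (hha z) c
      calc wC c * FC wA (f z) c * Hbar wA wB (h z) = wC c * (FC wA (f z) c * Hbar wA wB (h z)) := by ring
        _ ≤ wC c * Ybar wA wB (f z) (h z) c := mul_le_mul_of_nonneg_left this (hC0 c)
  · rw [e4]; exact sum_nonneg fun c _ => mul_nonneg (hC0 c) (sum_nonneg fun a _ => mul_nonneg (hA0 a) (hf0 z c a))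
  · rw [e6]; unfold Gbar GG
    exact sum_nonneg fun b _ => mul_nonneg (hB0 b) (sum_nonneg fun c _ => mul_nonneg (hC0 c) (hg0 z c b))
  · rw [e7]; unfold Hbar HH
    exact sum_nonneg fun b _ => mul_nonneg (hB0 b) (sum_nonneg fun a _ => mul_nonneg (hA0 a) (hh0 z a b))

end Facts

/-- Monotonicity in the hub level of the means and of `E(fg)` (sections increasing in `z`; nonnegative weights). [this work] -/
theorem level_mono (hA0 : ∀ a, 0 ≤ wA a) (hB0 : ∀ b, 0 ≤ wB b) (hC0 : ∀ c, 0 ≤ wC c)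
    (hf0 : ∀ z c a, 0 ≤ f z c a) (hfz : ∀ c a, f 0 c a ≤ f 1 c a)
    (hg0 : ∀ z c b, 0 ≤ g z c b) (hgz : ∀ c b, g 0 c b ≤ g 1 c b) :
    exL wA wB wC 0 (F1 f) ≤ exL wA wB wC 1 (F1 f) ∧ exL wA wB wC 0 (F2 g) ≤ exL wA wB wC 1 (F2 g) ∧
    exL wA wB wC 0 (F1 f * F2 g) ≤ exL wA wB wC 1 (F1 f * F2 g) := by
  have hW : ∀ q : α × β × γ, 0 ≤ WL wA wB wC q := fun q => mul_nonneg (mul_nonneg (hA0 _) (hB0 _)) (hC0 _)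
  unfold exL ex F1 F2
  refine ⟨sum_le_sum fun q _ => mul_le_mul_of_nonneg_left (hfz _ _) (hW q),
    sum_le_sum fun q _ => mul_le_mul_of_nonneg_left (hgz _ _) (hW q),
    sum_le_sum fun q _ => mul_le_mul_of_nonneg_left ?_ (hW q)⟩
  simp only [Pi.mul_apply]
  exact mul_le_mul (hfz _ _) (hgz _ _) (hg0 _ _ _) (hf0 _ _ _)

/-- With `h 0 = 0` every level-0 moment involving `h` vanishes, and so does `P₀`. [this work] -/
theorem level0_vanish (hh : ∀ a b, h 0 a b = 0) :
    exL wA wB wC 0 (F3 h) = 0 ∧ exL wA wB wC 0 (F1 f * F3 h) = 0 ∧ exL wA wB wC 0 (F2 g * F3 h) = 0 ∧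
    exL wA wB wC 0 (F1 f * F2 g * F3 h) = 0 ∧ levelE3 wA wB wC f g h 0 = 0 := by
  have z1 : exL wA wB wC 0 (F3 h) = 0 := by
    unfold exL ex F3; exact sum_eq_zero fun q _ => by simp [hh]
  have z2 : exL wA wB wC 0 (F1 f * F3 h) = 0 := by
    unfold exL ex F1 F3; exact sum_eq_zero fun q _ => by simp [hh]
  have z3 : exL wA wB wC 0 (F2 g * F3 h) = 0 := by
    unfold exL ex F2 F3; exact sum_eq_zero fun q _ => by simp [hh]
  have z4 : exL wA wB wC 0 (F1 f * F2 g * F3 h) = 0 := by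
    unfold exL ex F1 F2 F3; exact sum_eq_zero fun q _ => by simp [hh]
  refine ⟨z1, z2, z3, z4, ?_⟩
  unfold levelE3; rw [z1, z2, z3, z4]; ring


/-- **`q₁ ≥ 0` when the hub is required by `h`** (`h 0 = 0`). [this work] -/
theorem cornerQ1_nonneg_of_hub_required [DistribLattice α] [DistribLattice β] [DistribLattice γ]
    (hA : IsFKGMeasure wA) (hB : IsFKGMeasure wB) (hC : IsFKGMeasure wC)
    (hf0 : ∀ z c a, 0 ≤ f z c a) (hfa : ∀ z c, Monotone (f z c)) (hfc : ∀ z a, Monotone (fun c => f z c a))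
    (hfz : ∀ c a, f 0 c a ≤ f 1 c a)
    (hg0 : ∀ z c b, 0 ≤ g z c b) (hgb : ∀ z c, Monotone (g z c)) (hgc : ∀ z b, Monotone (fun c => g z c b))
    (hgz : ∀ c b, g 0 c b ≤ g 1 c b)
    (hh0 : ∀ z a b, 0 ≤ h z a b) (hha : ∀ z b, Monotone (fun a => h z a b)) (hhb : ∀ z a, Monotone (h z a))
    (hh : ∀ a b, h 0 a b = 0) :
    0 ≤ cornerQ1 wA wB wC f g h := by
  have hC0 := hC.nonneg; have hC1 := hC.sum_eq_one
  obtain ⟨gh1, fh1, F1p, G1p, H1p⟩ := level_facts (f := f) (g := g) (h := h) 1 hA hB hC0 hC1 hf0 hfa hg0 hgb hh0 hha hhb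
  obtain ⟨-, -, F0p, G0p, -⟩ := level_facts (f := f) (g := g) (h := h) 0 hA hB hC0 hC1 hf0 hfa hg0 hgb hh0 hha hhb
  obtain ⟨Fm, Gm, FGm⟩ := level_mono (f := f) (g := g) hA.nonneg hB.nonneg hC0 hf0 hfz hg0 hgz
  obtain ⟨z1, z2, z3, z4, zP⟩ := level0_vanish (wA := wA) (wB := wB) (wC := wC) (f := f) (g := g) hh
  have hP1 := levelE3_nonneg hA hB hC 1 (hf0 1) (hfa 1) (hfc 1) (hg0 1) (hgb 1) (hgc 1) (hh0 1) (hha 1) (hhb 1)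
  rw [cornerQ1_eq_levels, zP, z1, z2, z3]
  have t1 := mul_nonneg (sub_nonneg.2 Fm) (sub_nonneg.2 gh1)
  have t2 := mul_nonneg (sub_nonneg.2 Gm) (sub_nonneg.2 fh1)
  have t3 := mul_nonneg H1p (sub_nonneg.2 FGm)
  nlinarith [t1, t2, t3, hP1]

/-- **`q₀ ≥ 0` when the hub is required by `h`** (`h 0 = 0`): `q₀ ≥ H̄₁(F̄₁−F̄₀)(Ḡ₁−Ḡ₀) ≥ 0`. [this work] -/
theorem cornerQ0_nonneg_of_hub_required [DistribLattice α] [DistribLattice β] [DistribLattice γ]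
    (hA : IsFKGMeasure wA) (hB : IsFKGMeasure wB) (hC : IsFKGMeasure wC)
    (hf0 : ∀ z c a, 0 ≤ f z c a) (hfa : ∀ z c, Monotone (f z c)) (hfc : ∀ z a, Monotone (fun c => f z c a))
    (hfz : ∀ c a, f 0 c a ≤ f 1 c a)
    (hg0 : ∀ z c b, 0 ≤ g z c b) (hgb : ∀ z c, Monotone (g z c)) (hgc : ∀ z b, Monotone (fun c => g z c b))
    (hgz : ∀ c b, g 0 c b ≤ g 1 c b)
    (hh0 : ∀ z a b, 0 ≤ h z a b) (hha : ∀ z b, Monotone (fun a => h z a b)) (hhb : ∀ z a, Monotone (h z a))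
    (hh : ∀ a b, h 0 a b = 0) :
    0 ≤ cornerQ0 wA wB wC f g h := by
  have hC0 := hC.nonneg; have hC1 := hC.sum_eq_one
  obtain ⟨gh1, fh1, F1p, G1p, H1p⟩ := level_facts (f := f) (g := g) (h := h) 1 hA hB hC0 hC1 hf0 hfa hg0 hgb hh0 hha hhb
  obtain ⟨-, -, F0p, G0p, -⟩ := level_facts (f := f) (g := g) (h := h) 0 hA hB hC0 hC1 hf0 hfa hg0 hgb hh0 hha hhb
  obtain ⟨Fm, Gm, FGm⟩ := level_mono (f := f) (g := g) hA.nonneg hB.nonneg hC0 hf0 hfz hg0 hgz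
  obtain ⟨z1, z2, z3, z4, zP⟩ := level0_vanish (wA := wA) (wB := wB) (wC := wC) (f := f) (g := g) hh
  have hP1 := levelE3_nonneg hA hB hC 1 (hf0 1) (hfa 1) (hfc 1) (hg0 1) (hgb 1) (hgc 1) (hh0 1) (hha 1) (hhb 1)
  rw [cornerQ0_eq_levels, zP, z1, z2, z3]
  have t1 := mul_nonneg (sub_nonneg.2 Fm) (sub_nonneg.2 gh1)
  have t2 := mul_nonneg (sub_nonneg.2 Gm) (sub_nonneg.2 fh1)
  have t3 := mul_nonneg H1p (sub_nonneg.2 FGm)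
  have t4 := mul_nonneg H1p (mul_nonneg (sub_nonneg.2 Fm) (sub_nonneg.2 Gm))
  have t5 := mul_nonneg (sub_nonneg.2 Fm) (mul_nonneg G1p H1p)
  have t6 := mul_nonneg (sub_nonneg.2 Gm) (mul_nonneg F1p H1p)
  nlinarith [t1, t2, t3, t4, t5, t6, hP1]

/-- **THEOREM (Kahn's `C₃` on T₁ when the hub is REQUIRED by the third member).**  `α, β, γ` finite FKG lattices (`γ` = the
ARBITRARY co-shared block of the first two members), any hub weight `wZ ≥ 0` with `wZ 0 + wZ 1 = 1`; `f z c a, g z c b, h z a b`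
nonnegative and monotone in every argument (incl. `z`); and `h 0 = 0` (the third member requires the hub).  Then Sahi's `E₃ ≥ 0`
for the triple `(f,g,h)` on `α × β × (Fin 2 × γ)`.  For up-sets on a cube: `C₃` for every triple with exactly one triply-essential
coordinate which is required by one of the three events. [this work] -/
theorem sahiE_three_nonneg_T1_of_hub_required [DistribLattice α] [DistribLattice β] [DistribLattice γ]
    (hA : IsFKGMeasure wA) (hB : IsFKGMeasure wB) (hC : IsFKGMeasure wC)
    (hZ0 : 0 ≤ wZ 0) (hZ1 : 0 ≤ wZ 1) (hZ : wZ 0 + wZ 1 = 1)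
    (hf0 : ∀ z c a, 0 ≤ f z c a) (hfa : ∀ z c, Monotone (f z c)) (hfc : ∀ z a, Monotone (fun c => f z c a))
    (hfz : ∀ c a, f 0 c a ≤ f 1 c a)
    (hg0 : ∀ z c b, 0 ≤ g z c b) (hgb : ∀ z c, Monotone (g z c)) (hgc : ∀ z b, Monotone (fun c => g z c b))
    (hgz : ∀ c b, g 0 c b ≤ g 1 c b)
    (hh0 : ∀ z a b, 0 ≤ h z a b) (hha : ∀ z b, Monotone (fun a => h z a b)) (hhb : ∀ z a, Monotone (h z a))
    (hh : ∀ a b, h 0 a b = 0) :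
    0 ≤ sahiE (W wA wB wC wZ) 3 ![F1 f, F2 g, F3 h] :=
  sahiE_three_nonneg_T1_of_corner hA hB hC hZ0 hZ1 hZ hf0 hfa hfc hg0 hgb hgc hh0 hha hhb
    (cornerQ0_nonneg_of_hub_required hA hB hC hf0 hfa hfc hfz hg0 hgb hgc hgz hh0 hha hhb hh)
    (cornerQ1_nonneg_of_hub_required hA hB hC hf0 hfa hfc hfz hg0 hgb hgc hgz hh0 hha hhb hh)

/-! ### The hub required by one of the CO-SHARING members (`f 0 = 0`) -/

/-- More level facts: `E¹(fg) ≥ F̄₁Ḡ₁` (FKG on the block `γ`), `E⁰(gh) ≤ E¹(gh)`, `H̄₀ ≤ H̄₁` (sections increasing in `z`). [this work] -/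
theorem level_facts2 [DistribLattice γ] (hA0 : ∀ a, 0 ≤ wA a) (hA1 : ∑ a, wA a = 1) (hB0 : ∀ b, 0 ≤ wB b) (hB1 : ∑ b, wB b = 1)
    (hC : IsFKGMeasure wC)
    (hf0 : ∀ z c a, 0 ≤ f z c a) (hfc : ∀ z a, Monotone (fun c => f z c a))
    (hg0 : ∀ z c b, 0 ≤ g z c b) (hgc : ∀ z b, Monotone (fun c => g z c b)) (hgz : ∀ c b, g 0 c b ≤ g 1 c b)
    (hh0 : ∀ z a b, 0 ≤ h z a b) (hhz : ∀ a b, h 0 a b ≤ h 1 a b) :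
    exL wA wB wC 1 (F1 f) * exL wA wB wC 1 (F2 g) ≤ exL wA wB wC 1 (F1 f * F2 g) ∧
    exL wA wB wC 0 (F2 g * F3 h) ≤ exL wA wB wC 1 (F2 g * F3 h) ∧ exL wA wB wC 0 (F3 h) ≤ exL wA wB wC 1 (F3 h) := by
  have hC0 := hC.nonneg
  obtain ⟨-, e2, -, e4, -, e6, -⟩ := exL_moments (f := f) (g := g) (h := h) 1 hA1 hB1 hC.sum_eq_one
  have hW : ∀ q : α × β × γ, 0 ≤ WL wA wB wC q := fun q => mul_nonneg (mul_nonneg (hA0 _) (hB0 _)) (hC0 _)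
  refine ⟨?_, ?_, ?_⟩
  · rw [e2, e4, e6]
    have eg : Gbar wB wC (g 1) = ∑ c, wC c * GC wB (g 1) c := by
      unfold Gbar GG GC; exact SahiTriangleClassT.swap_bc wB wC (fun b c => g 1 c b)
    rw [eg]
    refine fkg_sum hC (fun c => sum_nonneg fun a _ => mul_nonneg (hA0 a) (hf0 1 c a))
      (fun c => sum_nonneg fun b _ => mul_nonneg (hB0 b) (hg0 1 c b)) ?_ ?_
    · exact fun c c' hcc => sum_le_sum fun a _ => mul_le_mul_of_nonneg_left (hfc 1 a hcc) (hA0 a)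
    · exact fun c c' hcc => sum_le_sum fun b _ => mul_le_mul_of_nonneg_left (hgc 1 b hcc) (hB0 b)
  · unfold exL ex F2 F3
    refine sum_le_sum fun q _ => mul_le_mul_of_nonneg_left ?_ (hW q)
    simp only [Pi.mul_apply]
    exact mul_le_mul (hgz _ _) (hhz _ _) (hh0 _ _ _) (hg0 _ _ _)
  · unfold exL ex F3
    exact sum_le_sum fun q _ => mul_le_mul_of_nonneg_left (hhz _ _) (hW q)

/-- With `f 0 = 0` every level-0 moment involving `f` vanishes, and so does `P₀`. [this work] -/
theorem level0_vanish_first (hf : ∀ c a, f 0 c a = 0) :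
    exL wA wB wC 0 (F1 f) = 0 ∧ exL wA wB wC 0 (F1 f * F2 g) = 0 ∧ exL wA wB wC 0 (F1 f * F3 h) = 0 ∧
    exL wA wB wC 0 (F1 f * F2 g * F3 h) = 0 ∧ levelE3 wA wB wC f g h 0 = 0 := by
  have z1 : exL wA wB wC 0 (F1 f) = 0 := by
    unfold exL ex F1; exact sum_eq_zero fun q _ => by simp [hf]
  have z2 : exL wA wB wC 0 (F1 f * F2 g) = 0 := by
    unfold exL ex F1 F2; exact sum_eq_zero fun q _ => by simp [hf]
  have z3 : exL wA wB wC 0 (F1 f * F3 h) = 0 := by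
    unfold exL ex F1 F3; exact sum_eq_zero fun q _ => by simp [hf]
  have z4 : exL wA wB wC 0 (F1 f * F2 g * F3 h) = 0 := by
    unfold exL ex F1 F2 F3; exact sum_eq_zero fun q _ => by simp [hf]
  refine ⟨z1, z2, z3, z4, ?_⟩
  unfold levelE3; rw [z1, z2, z3, z4]; ring

/-- **Both corner forms are `≥ 0` when the hub is required by the FIRST member** (`f 0 = 0`):
`q₁ = P₁ + F̄₁[E¹(gh) − E⁰(gh)] + ΔḠ·Cov¹(f,h) + ΔH̄·Cov¹(f,g)`, `q₀ ≥ F̄₁(Ḡ₁−Ḡ₀)(H̄₁−H̄₀)`. [this work] -/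
theorem corner_nonneg_of_hub_required_first [DistribLattice α] [DistribLattice β] [DistribLattice γ]
    (hA : IsFKGMeasure wA) (hB : IsFKGMeasure wB) (hC : IsFKGMeasure wC)
    (hf0 : ∀ z c a, 0 ≤ f z c a) (hfa : ∀ z c, Monotone (f z c)) (hfc : ∀ z a, Monotone (fun c => f z c a))
    (hg0 : ∀ z c b, 0 ≤ g z c b) (hgb : ∀ z c, Monotone (g z c)) (hgc : ∀ z b, Monotone (fun c => g z c b))
    (hgz : ∀ c b, g 0 c b ≤ g 1 c b)
    (hh0 : ∀ z a b, 0 ≤ h z a b) (hha : ∀ z b, Monotone (fun a => h z a b)) (hhb : ∀ z a, Monotone (h z a))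
    (hhz : ∀ a b, h 0 a b ≤ h 1 a b) (hf : ∀ c a, f 0 c a = 0) :
    0 ≤ cornerQ1 wA wB wC f g h ∧ 0 ≤ cornerQ0 wA wB wC f g h := by
  have hC0 := hC.nonneg; have hC1 := hC.sum_eq_one
  obtain ⟨gh1, fh1, F1p, G1p, H1p⟩ := level_facts (f := f) (g := g) (h := h) 1 hA hB hC0 hC1 hf0 hfa hg0 hgb hh0 hha hhb
  obtain ⟨gh0, -, -, G0p, H0p⟩ := level_facts (f := f) (g := g) (h := h) 0 hA hB hC0 hC1 hf0 hfa hg0 hgb hh0 hha hhb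
  obtain ⟨fg1, GHm, Hm⟩ := level_facts2 (f := f) (g := g) (h := h) hA.nonneg hA.sum_eq_one hB.nonneg hB.sum_eq_one hC
    hf0 hfc hg0 hgc hgz hh0 hhz
  obtain ⟨-, Gm, -⟩ := level_mono (wA := wA) (wB := wB) (wC := wC) (f := f) (g := g) hA.nonneg hB.nonneg hC0 hf0
    (fun c a => by rw [hf c a]; exact hf0 1 c a) hg0 hgz
  obtain ⟨z1, z2, z3, z4, zP⟩ := level0_vanish_first (wA := wA) (wB := wB) (wC := wC) (g := g) (h := h) hf
  have hP1 := levelE3_nonneg hA hB hC 1 (hf0 1) (hfa 1) (hfc 1) (hg0 1) (hgb 1) (hgc 1) (hh0 1) (hha 1) (hhb 1)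
  constructor
  · rw [cornerQ1_eq_levels, zP, z1, z2, z3]
    have t1 := mul_nonneg F1p (sub_nonneg.2 GHm)
    have t2 := mul_nonneg (sub_nonneg.2 Gm) (sub_nonneg.2 fh1)
    have t3 := mul_nonneg (sub_nonneg.2 Hm) (sub_nonneg.2 fg1)
    nlinarith [t1, t2, t3, hP1]
  · rw [cornerQ0_eq_levels, zP, z1, z2, z3]
    have t1 := mul_nonneg F1p (sub_nonneg.2 GHm)
    have t2 := mul_nonneg (sub_nonneg.2 Gm) (sub_nonneg.2 fh1)
    have t3 := mul_nonneg (sub_nonneg.2 Hm) (sub_nonneg.2 fg1)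
    have t4 := mul_nonneg F1p (mul_nonneg (sub_nonneg.2 Gm) (sub_nonneg.2 Hm))
    have t5 := mul_nonneg F1p (sub_nonneg.2 gh0)
    have t6 := mul_nonneg F1p (mul_nonneg G0p H0p)
    nlinarith [t1, t2, t3, t4, t5, t6, hP1]

/-- **THEOREM (hub required by a co-sharing member).**  Same setting; `f 0 = 0` (the first member requires the hub; `g, h`
monotone in `z`).  Then Sahi's `E₃ ≥ 0` / Kahn's `C₃` for `(f,g,h)`.  Together with `sahiE_three_nonneg_T1_of_hub_required`:
**`C₃` holds for every T₁ triple (one triply-essential coordinate, arbitrary FKG co-shared block) in which the hub is required by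
the third member or by one of the two co-sharing members** (the case `g 0 = 0` is the mirror image `f ↔ g`, `α ↔ β`). [this work] -/
theorem sahiE_three_nonneg_T1_of_hub_required_first [DistribLattice α] [DistribLattice β] [DistribLattice γ]
    (hA : IsFKGMeasure wA) (hB : IsFKGMeasure wB) (hC : IsFKGMeasure wC)
    (hZ0 : 0 ≤ wZ 0) (hZ1 : 0 ≤ wZ 1) (hZ : wZ 0 + wZ 1 = 1)
    (hf0 : ∀ z c a, 0 ≤ f z c a) (hfa : ∀ z c, Monotone (f z c)) (hfc : ∀ z a, Monotone (fun c => f z c a))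
    (hg0 : ∀ z c b, 0 ≤ g z c b) (hgb : ∀ z c, Monotone (g z c)) (hgc : ∀ z b, Monotone (fun c => g z c b))
    (hgz : ∀ c b, g 0 c b ≤ g 1 c b)
    (hh0 : ∀ z a b, 0 ≤ h z a b) (hha : ∀ z b, Monotone (fun a => h z a b)) (hhb : ∀ z a, Monotone (h z a))
    (hhz : ∀ a b, h 0 a b ≤ h 1 a b) (hf : ∀ c a, f 0 c a = 0) :
    0 ≤ sahiE (W wA wB wC wZ) 3 ![F1 f, F2 g, F3 h] := by
  obtain ⟨h1, h0⟩ := corner_nonneg_of_hub_required_first hA hB hC hf0 hfa hfc hg0 hgb hgc hgz hh0 hha hhb hhz hf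
  exact sahiE_three_nonneg_T1_of_corner hA hB hC hZ0 hZ1 hZ hf0 hfa hfc hg0 hgb hgc hh0 hha hhb h0 h1

/-! ### The hub required by the SECOND member (`g 0 = 0`) — mirror image -/

/-- Level facts for the mirror case: `E⁰(fh) ≤ E¹(fh)`, `F̄₀ ≤ F̄₁` (sections increasing in `z`). [this work] -/
theorem level_facts3 (hA0 : ∀ a, 0 ≤ wA a) (hB0 : ∀ b, 0 ≤ wB b) (hC0 : ∀ c, 0 ≤ wC c)
    (hf0 : ∀ z c a, 0 ≤ f z c a) (hfz : ∀ c a, f 0 c a ≤ f 1 c a)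
    (hh0 : ∀ z a b, 0 ≤ h z a b) (hhz : ∀ a b, h 0 a b ≤ h 1 a b) :
    exL wA wB wC 0 (F1 f * F3 h) ≤ exL wA wB wC 1 (F1 f * F3 h) ∧ exL wA wB wC 0 (F1 f) ≤ exL wA wB wC 1 (F1 f) := by
  have hW : ∀ q : α × β × γ, 0 ≤ WL wA wB wC q := fun q => mul_nonneg (mul_nonneg (hA0 _) (hB0 _)) (hC0 _)
  unfold exL ex F1 F3
  refine ⟨sum_le_sum fun q _ => mul_le_mul_of_nonneg_left ?_ (hW q), sum_le_sum fun q _ => mul_le_mul_of_nonneg_left (hfz _ _) (hW q)⟩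
  simp only [Pi.mul_apply]
  exact mul_le_mul (hfz _ _) (hhz _ _) (hh0 _ _ _) (hf0 _ _ _)

/-- With `g 0 = 0` every level-0 moment involving `g` vanishes, and so does `P₀`. [this work] -/
theorem level0_vanish_second (hg : ∀ c b, g 0 c b = 0) :
    exL wA wB wC 0 (F2 g) = 0 ∧ exL wA wB wC 0 (F1 f * F2 g) = 0 ∧ exL wA wB wC 0 (F2 g * F3 h) = 0 ∧
    exL wA wB wC 0 (F1 f * F2 g * F3 h) = 0 ∧ levelE3 wA wB wC f g h 0 = 0 := by
  have z1 : exL wA wB wC 0 (F2 g) = 0 := by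
    unfold exL ex F2; exact sum_eq_zero fun q _ => by simp [hg]
  have z2 : exL wA wB wC 0 (F1 f * F2 g) = 0 := by
    unfold exL ex F1 F2; exact sum_eq_zero fun q _ => by simp [hg]
  have z3 : exL wA wB wC 0 (F2 g * F3 h) = 0 := by
    unfold exL ex F2 F3; exact sum_eq_zero fun q _ => by simp [hg]
  have z4 : exL wA wB wC 0 (F1 f * F2 g * F3 h) = 0 := by
    unfold exL ex F1 F2 F3; exact sum_eq_zero fun q _ => by simp [hg]
  refine ⟨z1, z2, z3, z4, ?_⟩
  unfold levelE3; rw [z1, z2, z3, z4]; ring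

/-- **Both corner forms are `≥ 0` when the hub is required by the SECOND member** (`g 0 = 0`). [this work] -/
theorem corner_nonneg_of_hub_required_second [DistribLattice α] [DistribLattice β] [DistribLattice γ]
    (hA : IsFKGMeasure wA) (hB : IsFKGMeasure wB) (hC : IsFKGMeasure wC)
    (hf0 : ∀ z c a, 0 ≤ f z c a) (hfa : ∀ z c, Monotone (f z c)) (hfc : ∀ z a, Monotone (fun c => f z c a))
    (hfz : ∀ c a, f 0 c a ≤ f 1 c a)
    (hg0 : ∀ z c b, 0 ≤ g z c b) (hgb : ∀ z c, Monotone (g z c)) (hgc : ∀ z b, Monotone (fun c => g z c b))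
    (hh0 : ∀ z a b, 0 ≤ h z a b) (hha : ∀ z b, Monotone (fun a => h z a b)) (hhb : ∀ z a, Monotone (h z a))
    (hhz : ∀ a b, h 0 a b ≤ h 1 a b) (hg : ∀ c b, g 0 c b = 0) :
    0 ≤ cornerQ1 wA wB wC f g h ∧ 0 ≤ cornerQ0 wA wB wC f g h := by
  have hC0 := hC.nonneg; have hC1 := hC.sum_eq_one
  obtain ⟨gh1, fh1, F1p, G1p, H1p⟩ := level_facts (f := f) (g := g) (h := h) 1 hA hB hC0 hC1 hf0 hfa hg0 hgb hh0 hha hhb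
  obtain ⟨-, fh0, F0p, -, H0p⟩ := level_facts (f := f) (g := g) (h := h) 0 hA hB hC0 hC1 hf0 hfa hg0 hgb hh0 hha hhb
  obtain ⟨fg1, -, Hm⟩ := level_facts2 (f := f) (g := g) (h := h) hA.nonneg hA.sum_eq_one hB.nonneg hB.sum_eq_one hC
    hf0 hfc hg0 hgc (fun c b => by rw [hg c b]; exact hg0 1 c b) hh0 hhz
  obtain ⟨FHm, Fm⟩ := level_facts3 (wA := wA) (wB := wB) (wC := wC) (f := f) (h := h) hA.nonneg hB.nonneg hC0 hf0 hfz hh0 hhz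
  obtain ⟨z1, z2, z3, z4, zP⟩ := level0_vanish_second (wA := wA) (wB := wB) (wC := wC) (f := f) (h := h) hg
  have hP1 := levelE3_nonneg hA hB hC 1 (hf0 1) (hfa 1) (hfc 1) (hg0 1) (hgb 1) (hgc 1) (hh0 1) (hha 1) (hhb 1)
  constructor
  · rw [cornerQ1_eq_levels, zP, z1, z2, z3]
    have t1 := mul_nonneg G1p (sub_nonneg.2 FHm)
    have t2 := mul_nonneg (sub_nonneg.2 Fm) (sub_nonneg.2 gh1)
    have t3 := mul_nonneg (sub_nonneg.2 Hm) (sub_nonneg.2 fg1)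
    nlinarith [t1, t2, t3, hP1]
  · rw [cornerQ0_eq_levels, zP, z1, z2, z3]
    have t1 := mul_nonneg G1p (sub_nonneg.2 FHm)
    have t2 := mul_nonneg (sub_nonneg.2 Fm) (sub_nonneg.2 gh1)
    have t3 := mul_nonneg (sub_nonneg.2 Hm) (sub_nonneg.2 fg1)
    have t4 := mul_nonneg G1p (mul_nonneg (sub_nonneg.2 Fm) (sub_nonneg.2 Hm))
    have t5 := mul_nonneg G1p (sub_nonneg.2 fh0)
    have t6 := mul_nonneg G1p (mul_nonneg F0p H0p)
    nlinarith [t1, t2, t3, t4, t5, t6, hP1]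

/-- **THEOREM (hub required by the second member)**, mirror of `…_first`. [this work] -/
theorem sahiE_three_nonneg_T1_of_hub_required_second [DistribLattice α] [DistribLattice β] [DistribLattice γ]
    (hA : IsFKGMeasure wA) (hB : IsFKGMeasure wB) (hC : IsFKGMeasure wC)
    (hZ0 : 0 ≤ wZ 0) (hZ1 : 0 ≤ wZ 1) (hZ : wZ 0 + wZ 1 = 1)
    (hf0 : ∀ z c a, 0 ≤ f z c a) (hfa : ∀ z c, Monotone (f z c)) (hfc : ∀ z a, Monotone (fun c => f z c a))
    (hfz : ∀ c a, f 0 c a ≤ f 1 c a)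
    (hg0 : ∀ z c b, 0 ≤ g z c b) (hgb : ∀ z c, Monotone (g z c)) (hgc : ∀ z b, Monotone (fun c => g z c b))
    (hh0 : ∀ z a b, 0 ≤ h z a b) (hha : ∀ z b, Monotone (fun a => h z a b)) (hhb : ∀ z a, Monotone (h z a))
    (hhz : ∀ a b, h 0 a b ≤ h 1 a b) (hg : ∀ c b, g 0 c b = 0) :
    0 ≤ sahiE (W wA wB wC wZ) 3 ![F1 f, F2 g, F3 h] := by
  obtain ⟨h1, h0⟩ := corner_nonneg_of_hub_required_second hA hB hC hf0 hfa hfc hfz hg0 hgb hgc hh0 hha hhb hhz hg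
  exact sahiE_three_nonneg_T1_of_corner hA hB hC hZ0 hZ1 hZ hf0 hfa hfc hg0 hgb hgc hh0 hha hhb h0 h1

end SahiHubCorner

end Summit.CriticalPhenomena.PercolationContinuityZ3.Theorems
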